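import Mathlib
import Summits.Ventures.PercRepro2.Defs
import Summits.Ventures.PercRepro2.Independence
import Summits.Ventures.PercRepro2.Harris

/-!
# (ZC) when the root has no neighbour outside `{a₃, o}` — the two-edge theorem
(blind cell PercRepro2, mine-a g22; MINE-A.md §69.2, Theorem A)

The four-mark inequality (ZC) of MINE-A.md §66,
`P(D) · Cov(U, eL) ≥ P(B) · Cov(U, e¬L)`  (`e = {a₃ ∈ C₁}`, `L = {o ∈ C₁}`, `U = {C₁ ∈ 𝒰}`,
`B = [a₁ | a₃o]`, `D = [a₁ | a₃ | o]`), is proved here for every graph in which the root `a₁` is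
joined to the rest only through the two edges `f₁ = a₁a₃` and `f₂ = a₁o`.

The statement is abstract: `A'` is the event `{a₃ ↔ o}` of the graph `G − a₁` (it ignores `f₁`,
`f₂`), and `X₁`, `X₂`, `X₁₂` are the events `{C(a₃) ∪ {a₁} ∈ 𝒰}`, `{C(o) ∪ {a₁} ∈ 𝒰}`,
`{C(a₃) ∪ C(o) ∪ {a₁} ∈ 𝒰}` of `G − a₁` (increasing, ignoring `f₁`, `f₂`, with
`X₁ ∪ X₂ ⊆ X₁₂` and `X₁ ∩ A' = X₂ ∩ A' = X₁₂ ∩ A'`).  In that graph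
`e = {f₁ open} ∪ ({f₂ open} ∩ A')`, `L = {f₂ open} ∪ ({f₁ open} ∩ A')`,
`U = ({f₁ open, f₂ closed} ∩ X₁) ∪ ({f₁ closed, f₂ open} ∩ X₂) ∪ ({f₁, f₂ open} ∩ X₁₂)`,
`{a₃ ↔ o} = A' ∪ {f₁, f₂ open}` — and nothing else about the graph is used.

The proof: expand every probability over the four states of `(f₁, f₂)` (`prob_two_pin`), so that
everything is a polynomial in `p f₁`, `p f₂`, `g = P(A')`, `a = P(X₁₂ ∩ A')`, `z = P(X₁₂ ∩ A'ᶜ)`,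
`b = P(X₁ ∩ A'ᶜ)`, `d = P(X₂ ∩ A'ᶜ)`; ONE Harris inequality in `G − a₁` (`X₁₂` and `A'` increasing)
gives `(1 − g) a ≥ g z`; monotonicity gives `b, d ≤ z`; and the polynomial identity
`(ZC) = (1−p₁)(1−p₂) · { π₂(1 − p₂π)[(1−g)a − gz] + c_β(z − b) + c_δ(z − d) + p₂π(1−p₁)(1−p₂) z }`
(`π₂ = p₁ + p₂ − p₁p₂`, `π = g + p₁ − g p₁`, `c_β = p₁(1−p₂)(g + (1−g)p₂π)`, `c_δ = (1−g)(1−p₁)p₂²π`)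
exhibits the slack as a sum of products of nonnegative factors, with the explicit lower bound
`(1−p₁)²(1−p₂)² p₂ π z`.  One seat; every identity twinned in exact rational arithmetic
(data/mine-a/g22/codes/thmA.py, 199 cells).
-/

namespace Summit.Ventures.PercRepro2

section TwoEdgePin

variable {E : Type*} [Fintype E] [DecidableEq E] {R : Type*} [CommRing R]

/-- `P_{p[e↦1]}(A) = P_p({ω ∣ ω[e ↦ open] ∈ A})`. -/
lemma prob_update_one_eq_shift (p : E → R) (e : E) (A : Set (Config E)) :
    prob (Function.update p e 1) A = prob p {ω | Function.update ω e true ∈ A} := by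
  rw [prob_eq_expect_indicator, expect_update_one, prob_eq_expect_indicator]
  congr 1

/-- `P_{p[e↦0]}(A) = P_p({ω ∣ ω[e ↦ closed] ∈ A})`. -/
lemma prob_update_zero_eq_shift (p : E → R) (e : E) (A : Set (Config E)) :
    prob (Function.update p e 0) A = prob p {ω | Function.update ω e false ∈ A} := by
  rw [prob_eq_expect_indicator, expect_update_zero, prob_eq_expect_indicator]
  congr 1

/-- **Two-edge pinning**: the probability of any event is the mixture, over the four states of two
distinct edges `f₁`, `f₂`, of the probabilities of the event with those edges forced. -/
lemma prob_two_pin (p : E → R) {f₁ f₂ : E} (hf : f₁ ≠ f₂) (Z : Set (Config E)) :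
    prob p Z = p f₁ * p f₂ * prob p {ω | Function.update (Function.update ω f₁ true) f₂ true ∈ Z}
      + p f₁ * (1 - p f₂) * prob p {ω | Function.update (Function.update ω f₁ true) f₂ false ∈ Z}
      + (1 - p f₁) * p f₂ * prob p {ω | Function.update (Function.update ω f₁ false) f₂ true ∈ Z}
      + (1 - p f₁) * (1 - p f₂)
        * prob p {ω | Function.update (Function.update ω f₁ false) f₂ false ∈ Z} := by
  have h21 : Function.update p f₁ (1 : R) f₂ = p f₂ := Function.update_of_ne hf.symm _ _
  have h20 : Function.update p f₁ (0 : R) f₂ = p f₂ := Function.update_of_ne hf.symm _ _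
  rw [prob_eq_pin p Z f₁, prob_eq_pin (Function.update p f₁ 1) Z f₂,
    prob_eq_pin (Function.update p f₁ 0) Z f₂, h21, h20]
  simp only [prob_update_one_eq_shift, prob_update_zero_eq_shift, Set.mem_setOf_eq]
  ring

end TwoEdgePin

section TwoEdgeEvents

variable {E : Type*} [DecidableEq E]

/-- The first of two forced edges reads the first forced value. -/
lemma update2_fst {f₁ f₂ : E} (hf : f₁ ≠ f₂) (ω : Config E) (b₁ b₂ : Bool) :
    Function.update (Function.update ω f₁ b₁) f₂ b₂ f₁ = b₁ := by
  rw [Function.update_of_ne hf, Function.update_self]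

/-- The second of two forced edges reads the second forced value. -/
lemma update2_snd {f₁ f₂ : E} (ω : Config E) (b₁ b₂ : Bool) :
    Function.update (Function.update ω f₁ b₁) f₂ b₂ f₂ = b₂ :=
  Function.update_self ..

end TwoEdgeEvents

section TwoEdgeTheorem

variable {E : Type*} [Fintype E] [DecidableEq E] {R : Type*} [CommRing R] [LinearOrder R]
  [IsStrictOrderedRing R]


/-- The algebraic core of Theorem A: with `p₁ = p f₁`, `p₂ = p f₂`, `g = P(A')`, `a = P(X₁₂ ∩ A')`,
`z = P(X₁₂ ∩ A'ᶜ)`, `b = P(X₁ ∩ A'ᶜ)`, `d = P(X₂ ∩ A'ᶜ)`, the (ZC) expression minus the explicit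
bound equals `(1−p₁)(1−p₂)·{π₂(1−p₂π)[(1−g)a − gz] + c_β(z − b) + c_δ(z − d)}`, a sum of products
of nonnegative factors (`(1−g)a ≥ gz` is the Harris inequality, `b, d ≤ z` the monotonicity). -/
lemma zc_two_edge_alg (p₁ p₂ g a z b d : R) (hp1 : 0 ≤ p₁) (hp1' : p₁ ≤ 1) (hp2 : 0 ≤ p₂)
    (hp2' : p₂ ≤ 1) (hg0 : 0 ≤ g) (hg1 : g ≤ 1) (hHar : (a + z) * g ≤ a) (hzb : b ≤ z)
    (hzd : d ≤ z) :
    (1 - p₁) * (1 - p₂) * (1 - g) *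
      (p₁ * p₂ * (a + z) + p₁ * (1 - p₂) * a + (1 - p₁) * p₂ * a
        - (p₁ * p₂ * (a + z) + p₁ * (1 - p₂) * (a + b) + (1 - p₁) * p₂ * (a + d))
          * (p₁ * p₂ + p₁ * (1 - p₂) * g + (1 - p₁) * p₂ * g))
      - (1 - p₁) * (1 - p₂) * g *
        (p₁ * (1 - p₂) * b
          - (p₁ * p₂ * (a + z) + p₁ * (1 - p₂) * (a + b) + (1 - p₁) * p₂ * (a + d))
            * (p₁ * (1 - p₂) * (1 - g)))
      ≥ (1 - p₁) ^ 2 * (1 - p₂) ^ 2 * p₂ * (g + p₁ - g * p₁) * z := by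
  have h1p : 0 ≤ 1 - p₁ := sub_nonneg.2 hp1'
  have h1q : 0 ≤ 1 - p₂ := sub_nonneg.2 hp2'
  have h1g : 0 ≤ 1 - g := sub_nonneg.2 hg1
  have hπ0 : 0 ≤ g + p₁ - g * p₁ := by
    have := mul_nonneg hg0 h1p; linarith
  have hπ : g + p₁ - g * p₁ ≤ 1 := by
    have := mul_nonneg h1g h1p; linarith
  have hqπ : 0 ≤ 1 - p₂ * (g + p₁ - g * p₁) := by
    have := mul_le_mul_of_nonneg_right hp2' hπ0; linarith
  have hπ₂ : 0 ≤ p₁ + p₂ - p₁ * p₂ := by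
    have := mul_nonneg hp2 h1p; linarith
  have hHar' : 0 ≤ (1 - g) * a - g * z := by linarith
  have hcβ : 0 ≤ p₁ * (1 - p₂) * (g + (1 - g) * p₂ * (g + p₁ - g * p₁)) :=
    mul_nonneg (mul_nonneg hp1 h1q)
      (add_nonneg hg0 (mul_nonneg (mul_nonneg h1g hp2) hπ0))
  have hcδ : 0 ≤ (1 - g) * (1 - p₁) * p₂ ^ 2 * (g + p₁ - g * p₁) :=
    mul_nonneg (mul_nonneg (mul_nonneg h1g h1p) (sq_nonneg _)) hπ0
  have hnn : 0 ≤ (1 - p₁) * (1 - p₂) *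
        ((p₁ + p₂ - p₁ * p₂) * (1 - p₂ * (g + p₁ - g * p₁)) * ((1 - g) * a - g * z)
          + p₁ * (1 - p₂) * (g + (1 - g) * p₂ * (g + p₁ - g * p₁)) * (z - b)
          + (1 - g) * (1 - p₁) * p₂ ^ 2 * (g + p₁ - g * p₁) * (z - d)) :=
    mul_nonneg (mul_nonneg h1p h1q)
      (add_nonneg (add_nonneg (mul_nonneg (mul_nonneg hπ₂ hqπ) hHar')
        (mul_nonneg hcβ (sub_nonneg.2 hzb))) (mul_nonneg hcδ (sub_nonneg.2 hzd)))
  have key : (1 - p₁) * (1 - p₂) * (1 - g) *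
      (p₁ * p₂ * (a + z) + p₁ * (1 - p₂) * a + (1 - p₁) * p₂ * a
        - (p₁ * p₂ * (a + z) + p₁ * (1 - p₂) * (a + b) + (1 - p₁) * p₂ * (a + d))
          * (p₁ * p₂ + p₁ * (1 - p₂) * g + (1 - p₁) * p₂ * g))
      - (1 - p₁) * (1 - p₂) * g *
        (p₁ * (1 - p₂) * b
          - (p₁ * p₂ * (a + z) + p₁ * (1 - p₂) * (a + b) + (1 - p₁) * p₂ * (a + d))
            * (p₁ * (1 - p₂) * (1 - g)))
      - (1 - p₁) ^ 2 * (1 - p₂) ^ 2 * p₂ * (g + p₁ - g * p₁) * z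
      = (1 - p₁) * (1 - p₂) *
        ((p₁ + p₂ - p₁ * p₂) * (1 - p₂ * (g + p₁ - g * p₁)) * ((1 - g) * a - g * z)
          + p₁ * (1 - p₂) * (g + (1 - g) * p₂ * (g + p₁ - g * p₁)) * (z - b)
          + (1 - g) * (1 - p₁) * p₂ ^ 2 * (g + p₁ - g * p₁) * (z - d)) := by ring
  linarith [key, hnn]

/-- **Theorem A (MINE-A.md §69.2)** — (ZC) for every graph in which the root `a₁` is joined to
the rest only by the two edges `f₁ = a₁a₃` (weight `p f₁`) and `f₂ = a₁o` (weight `p f₂`), for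
every cluster up-set: with `e`, `L`, `U`, `γ` as above and `B = eᶜ ∩ Lᶜ ∩ γ`, `D = eᶜ ∩ Lᶜ ∩ γᶜ`,
  `P(D) · (P(U ∩ e ∩ L) − P(U) P(e ∩ L)) − P(B) · (P(U ∩ e ∩ Lᶜ) − P(U) P(e ∩ Lᶜ))`
  `≥ (1 − p f₁)² (1 − p f₂)² · p f₂ · (g + p f₁ − g · p f₁) · P(X₁₂ ∩ A'ᶜ) ≥ 0`, `g = P(A')`.
Inputs: `A'`, `X₁`, `X₂`, `X₁₂` ignore `f₁`, `f₂` (membership is invariant under forcing them); `A'`, `X₁₂` increasing (one Harris inequality);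
`X₁ ∩ A' = X₁₂ ∩ A'`, `X₂ ∩ A' = X₁₂ ∩ A'` (on `a₃ ↔ o` the three glued clusters coincide);
`X₁ ⊆ X₁₂`, `X₂ ⊆ X₁₂` (monotonicity of the up-set). -/
theorem zc_two_edge {p : E → R} (hp : IsProbVec p) {f₁ f₂ : E} (hf : f₁ ≠ f₂)
    {A' X₁ X₂ X₁₂ : Set (Config E)}
    (hA' : ∀ (ω : Config E) (b₁ b₂ : Bool),
      Function.update (Function.update ω f₁ b₁) f₂ b₂ ∈ A' ↔ ω ∈ A')
    (hX₁ : ∀ (ω : Config E) (b₁ b₂ : Bool),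
      Function.update (Function.update ω f₁ b₁) f₂ b₂ ∈ X₁ ↔ ω ∈ X₁)
    (hX₂ : ∀ (ω : Config E) (b₁ b₂ : Bool),
      Function.update (Function.update ω f₁ b₁) f₂ b₂ ∈ X₂ ↔ ω ∈ X₂)
    (hX₁₂ : ∀ (ω : Config E) (b₁ b₂ : Bool),
      Function.update (Function.update ω f₁ b₁) f₂ b₂ ∈ X₁₂ ↔ ω ∈ X₁₂)
    (hA'up : IsUpperSet A') (hX₁₂up : IsUpperSet X₁₂)
    (h1 : X₁ ∩ A' = X₁₂ ∩ A') (h2 : X₂ ∩ A' = X₁₂ ∩ A') (h1s : X₁ ⊆ X₁₂) (h2s : X₂ ⊆ X₁₂) :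
    let e := openEdge f₁ ∪ (openEdge f₂ ∩ A')
    let L := openEdge f₂ ∪ (openEdge f₁ ∩ A')
    let U := (openEdge f₁ ∩ closedEdge f₂ ∩ X₁) ∪ (closedEdge f₁ ∩ openEdge f₂ ∩ X₂)
      ∪ (openEdge f₁ ∩ openEdge f₂ ∩ X₁₂)
    let γ := A' ∪ (openEdge f₁ ∩ openEdge f₂)
    prob p (eᶜ ∩ Lᶜ ∩ γᶜ) * (prob p (U ∩ (e ∩ L)) - prob p U * prob p (e ∩ L))
      - prob p (eᶜ ∩ Lᶜ ∩ γ) * (prob p (U ∩ (e ∩ Lᶜ)) - prob p U * prob p (e ∩ Lᶜ))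
      ≥ (1 - p f₁) ^ 2 * (1 - p f₂) ^ 2 * p f₂ * (prob p A' + p f₁ - prob p A' * p f₁)
        * prob p (X₁₂ ∩ A'ᶜ) := by
  intro e L U γ
  -- the forced events
  have hs1 := update2_fst hf
  -- closed forms of the seven probabilities
  set g := prob p A' with hg
  set a := prob p (X₁₂ ∩ A') with ha
  set z := prob p (X₁₂ ∩ A'ᶜ) with hz
  set b := prob p (X₁ ∩ A'ᶜ) with hb
  set d := prob p (X₂ ∩ A'ᶜ) with hd
  have hX12 : prob p X₁₂ = a + z := (prob_inter_add_prob_inter_compl p X₁₂ A').symm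
  have hX1 : prob p X₁ = a + b := by
    rw [← prob_inter_add_prob_inter_compl p X₁ A', h1]
  have hX2 : prob p X₂ = a + d := by
    rw [← prob_inter_add_prob_inter_compl p X₂ A', h2]
  have hAc : prob p A'ᶜ = 1 - g := prob_compl p A'
  have PeL : prob p (e ∩ L) = p f₁ * p f₂ + p f₁ * (1 - p f₂) * g + (1 - p f₁) * p f₂ * g := by
    rw [prob_two_pin p hf]
    have e11 : {ω | Function.update (Function.update ω f₁ true) f₂ true ∈ (e ∩ L)} = Set.univ := by
      ext ω; simp [e, L, hs1, hA']
    have e10 : {ω | Function.update (Function.update ω f₁ true) f₂ false ∈ (e ∩ L)} = A' := by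
      ext ω; simp [e, L, hs1, hA']
    have e01 : {ω | Function.update (Function.update ω f₁ false) f₂ true ∈ (e ∩ L)} = A' := by
      ext ω; simp [e, L, hs1, hA']
    have e00 : {ω | Function.update (Function.update ω f₁ false) f₂ false ∈ (e ∩ L)} = ∅ := by
      ext ω; simp [e, L, hs1, hA']
    rw [e11, e10, e01, e00, prob_univ, prob_empty]; ring
  have PUeL : prob p (U ∩ (e ∩ L)) = p f₁ * p f₂ * (a + z) + p f₁ * (1 - p f₂) * a
      + (1 - p f₁) * p f₂ * a := by
    rw [prob_two_pin p hf]
    have e11 : {ω | Function.update (Function.update ω f₁ true) f₂ true ∈ (U ∩ (e ∩ L))} = X₁₂ := by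
      ext ω; simp [e, L, U, hs1, hA', hX₁₂]
    have e10 : {ω | Function.update (Function.update ω f₁ true) f₂ false ∈ (U ∩ (e ∩ L))} = X₁ ∩ A' := by
      ext ω; simp [e, L, U, hs1, hA', hX₁]
    have e01 : {ω | Function.update (Function.update ω f₁ false) f₂ true ∈ (U ∩ (e ∩ L))} = X₂ ∩ A' := by
      ext ω; simp [e, L, U, hs1, hA', hX₂]
    have e00 : {ω | Function.update (Function.update ω f₁ false) f₂ false ∈ (U ∩ (e ∩ L))} = ∅ := by
      ext ω; simp [e, L, U, hs1]
    rw [e11, e10, e01, e00, prob_empty, hX12, h1, h2]; ring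
  have PenL : prob p (e ∩ Lᶜ) = p f₁ * (1 - p f₂) * (1 - g) := by
    rw [prob_two_pin p hf]
    have e11 : {ω | Function.update (Function.update ω f₁ true) f₂ true ∈ (e ∩ Lᶜ)} = ∅ := by
      ext ω; simp [e, L, hs1]
    have e10 : {ω | Function.update (Function.update ω f₁ true) f₂ false ∈ (e ∩ Lᶜ)} = A'ᶜ := by
      ext ω; simp [e, L, hs1, hA']
    have e01 : {ω | Function.update (Function.update ω f₁ false) f₂ true ∈ (e ∩ Lᶜ)} = ∅ := by
      ext ω; simp [e, L, hs1]
    have e00 : {ω | Function.update (Function.update ω f₁ false) f₂ false ∈ (e ∩ Lᶜ)} = ∅ := by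
      ext ω; simp [e, L, hs1]
    rw [e11, e10, e01, e00, prob_empty, hAc]; ring
  have PUenL : prob p (U ∩ (e ∩ Lᶜ)) = p f₁ * (1 - p f₂) * b := by
    rw [prob_two_pin p hf]
    have e11 : {ω | Function.update (Function.update ω f₁ true) f₂ true ∈ (U ∩ (e ∩ Lᶜ))} = ∅ := by
      ext ω; simp [e, L, U, hs1]
    have e10 : {ω | Function.update (Function.update ω f₁ true) f₂ false ∈ (U ∩ (e ∩ Lᶜ))} = X₁ ∩ A'ᶜ := by
      ext ω; simp [e, L, U, hs1, hA', hX₁]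
    have e01 : {ω | Function.update (Function.update ω f₁ false) f₂ true ∈ (U ∩ (e ∩ Lᶜ))} = ∅ := by
      ext ω; simp [e, L, U, hs1]
    have e00 : {ω | Function.update (Function.update ω f₁ false) f₂ false ∈ (U ∩ (e ∩ Lᶜ))} = ∅ := by
      ext ω; simp [e, L, U, hs1]
    rw [e11, e10, e01, e00, prob_empty]; ring
  have PU : prob p U = p f₁ * p f₂ * (a + z) + p f₁ * (1 - p f₂) * (a + b)
      + (1 - p f₁) * p f₂ * (a + d) := by
    rw [prob_two_pin p hf]
    have e11 : {ω | Function.update (Function.update ω f₁ true) f₂ true ∈ U} = X₁₂ := by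
      ext ω; simp [U, hs1, hX₁₂]
    have e10 : {ω | Function.update (Function.update ω f₁ true) f₂ false ∈ U} = X₁ := by
      ext ω; simp [U, hs1, hX₁]
    have e01 : {ω | Function.update (Function.update ω f₁ false) f₂ true ∈ U} = X₂ := by
      ext ω; simp [U, hs1, hX₂]
    have e00 : {ω | Function.update (Function.update ω f₁ false) f₂ false ∈ U} = ∅ := by
      ext ω; simp [U, hs1]
    rw [e11, e10, e01, e00, prob_empty, hX12, hX1, hX2]; ring
  have PB : prob p (eᶜ ∩ Lᶜ ∩ γ) = (1 - p f₁) * (1 - p f₂) * g := by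
    rw [prob_two_pin p hf]
    have e11 : {ω | Function.update (Function.update ω f₁ true) f₂ true ∈ (eᶜ ∩ Lᶜ ∩ γ)} = ∅ := by
      ext ω; simp [e, L, γ, hs1]
    have e10 : {ω | Function.update (Function.update ω f₁ true) f₂ false ∈ (eᶜ ∩ Lᶜ ∩ γ)} = ∅ := by
      ext ω; simp [e, L, γ, hs1]
    have e01 : {ω | Function.update (Function.update ω f₁ false) f₂ true ∈ (eᶜ ∩ Lᶜ ∩ γ)} = ∅ := by
      ext ω; simp [e, L, γ, hs1]
    have e00 : {ω | Function.update (Function.update ω f₁ false) f₂ false ∈ (eᶜ ∩ Lᶜ ∩ γ)} = A' := by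
      ext ω; simp [e, L, γ, hs1, hA']
    rw [e11, e10, e01, e00, prob_empty]; ring
  have PD : prob p (eᶜ ∩ Lᶜ ∩ γᶜ) = (1 - p f₁) * (1 - p f₂) * (1 - g) := by
    rw [prob_two_pin p hf]
    have e11 : {ω | Function.update (Function.update ω f₁ true) f₂ true ∈ (eᶜ ∩ Lᶜ ∩ γᶜ)} = ∅ := by
      ext ω; simp [e, L, γ, hs1]
    have e10 : {ω | Function.update (Function.update ω f₁ true) f₂ false ∈ (eᶜ ∩ Lᶜ ∩ γᶜ)} = ∅ := by
      ext ω; simp [e, L, γ, hs1]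
    have e01 : {ω | Function.update (Function.update ω f₁ false) f₂ true ∈ (eᶜ ∩ Lᶜ ∩ γᶜ)} = ∅ := by
      ext ω; simp [e, L, γ, hs1]
    have e00 : {ω | Function.update (Function.update ω f₁ false) f₂ false ∈ (eᶜ ∩ Lᶜ ∩ γᶜ)} = A'ᶜ := by
      ext ω; simp [e, L, γ, hs1, hA']
    rw [e11, e10, e01, e00, prob_empty, hAc]; ring
  -- the probabilistic inputs
  have hHar : (a + z) * g ≤ a := by
    have := prob_mul_prob_le_prob_inter hp hX₁₂up hA'up
    rwa [hX12] at this
  have hzb : b ≤ z := prob_mono hp (Set.inter_subset_inter_left _ h1s)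
  have hzd : d ≤ z := prob_mono hp (Set.inter_subset_inter_left _ h2s)
  have ha0 : 0 ≤ a := prob_nonneg hp _
  have hz0 : 0 ≤ z := prob_nonneg hp _
  have hb0 : 0 ≤ b := prob_nonneg hp _
  have hd0 : 0 ≤ d := prob_nonneg hp _
  have hg0 : 0 ≤ g := prob_nonneg hp _
  have hg1 : g ≤ 1 := prob_le_one hp _
  have hp1 := hp.nonneg f₁
  have hp1' := hp.le_one f₁
  have hp2 := hp.nonneg f₂
  have hp2' := hp.le_one f₂
  -- the algebra
  rw [PeL, PUeL, PenL, PUenL, PU, PB, PD]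
  exact zc_two_edge_alg (p f₁) (p f₂) g a z b d hp1 hp1' hp2 hp2' hg0 hg1 hHar hzb hzd

end TwoEdgeTheorem

end Summit.Ventures.PercRepro2
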